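import Mathlib
import Summits.Ventures.PercRepro2.LocRows
import Summits.Ventures.PercRepro2.SwRow
import Summits.Ventures.PercRepro2.SwOut
import Summits.Ventures.PercRepro2.SwAllRow
import Summits.Ventures.PercRepro2.SwOutAll
import Summits.Ventures.PercRepro2.SwOutArmFlip
import Summits.Ventures.PercRepro2.SwOutArms
import Summits.Ventures.PercRepro2.SwOutArmOrbit
import Summits.Ventures.PercRepro2.SwOutArmCube
import Summits.Ventures.PercRepro2.SwOutArmThm
import Summits.Ventures.PercRepro2.SwOutCoreDefs
import Summits.Ventures.PercRepro2.SwOutCoreCube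
import Summits.Ventures.PercRepro2.SwOutCoreKey
import Summits.Ventures.PercRepro2.SwOutCoreShadowKey
import Summits.Ventures.PercRepro2.SwOutJunctionH1Defs
import Summits.Ventures.PercRepro2.SwOutJunctionH1Arms
import Summits.Ventures.PercRepro2.SwOutJunctionH1Kinds
import Summits.Ventures.PercRepro2.SwOutJunctionH1Orbit
import Summits.Ventures.PercRepro2.SwOutBigBlockDefs
import Summits.Ventures.PercRepro2.SwOutMixedBaseDefs
import Summits.Ventures.PercRepro2.SwOutMixedCore
import Summits.Ventures.PercRepro2.SwOutMixedCoreEdgeMap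
import Summits.Ventures.PercRepro2.SwOutMixedCoreClass
import Summits.Ventures.PercRepro2.SwOutMixedCoreClassIff
import Summits.Ventures.PercRepro2.SwOutMixedCoreBlockThm
import Summits.Ventures.PercRepro2.SwOutMixedPartDefs
import Summits.Ventures.PercRepro2.SwOutMixedPartBase
import Summits.Ventures.PercRepro2.SwOutMixedPartCoreKey
import Summits.Ventures.PercRepro2.SwOutMixedPartKey
import Summits.Ventures.PercRepro2.SwOutMixedPartOrbitDefs
import Summits.Ventures.PercRepro2.SwOutMixedPartOrbit
import Summits.Ventures.PercRepro2.SwOutMixedPartArmsUnion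
import Summits.Ventures.PercRepro2.SwOutMixedPartEsc
import Summits.Ventures.PercRepro2.SwOutMixedPartBaseE
import Summits.Ventures.PercRepro2.SwOutMixedPartClass
import Summits.Ventures.PercRepro2.SwOutMixedPartKeyDefs

/-!
# The mixed block of a core-kind point: every `Q`-point carries the same key, and the block
satisfies the rigid inequality (blind cell PercRepro2, night-4 g19, 2026-08-27;
proofs/NIGHT4-G19.md §6)

For a core-kind `Q`-point `ζ₀` with blue dead edges of a class with a mixed single junction (the
h-piece connected, `o` outside the component of `p`): every `Q`-point of its mixed block lies in
the class with the key of `ζ₀` (**`keyM_eq_of_mem_mixedBlock`** — a core point by the constancy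
of `SwOutMixedPartKey`, an escaping point by `baseE_esc` and `not_hull_u_subset_esc`), and the
block satisfies the rigid counting inequality (**`card_mixedBlock_le`**, from `rigid_block` with
the non-degeneracy of `SwOutMixedPartClass`).  Also the bundle of facts about the base
(`mixedFacts`).
-/

namespace Summit.Ventures.PercRepro2

namespace BigBlock

open Hull LocRows

variable {V : Type*} {E : Type*} [Fintype E] [DecidableEq E]

open scoped Classical

variable {ends : E → Sym2 V} {U : Set V} {ξ : Config E} {l h o u p : V}

variable (hj : MixedJunction ends U h u p o) (hl : l ∉ U) (ho : o ∉ compU ends U h u p)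
  (hAh : AhConn ends U ξ l h o u p)
include hj hl ho hAh

omit ho hAh in
/-- The data of the point is the data of its base. -/
theorem mixedData_coreBaseOf {ζ₀ : Config E} (hζ₀ : ζ₀ ∈ swOutSide ends l h o U ξ)
    (hk₀ : CoreKind ends U h u ζ₀) (hd₀ : DeadBlue ends h u p ζ₀) :
    mixedData ends h u p (coreBaseOf ends ζ₀ h u) = mixedData ends h u p ζ₀ := by
  have htop := mixedReal_top (ends := ends) (u := u) (p := p)
    (U := fun P : uArms ends h u p ζ₀ => P.1) (Ah := AhOf ends h u p ζ₀)
    (F := fun P : farArms ends h u p ζ₀ => P.1) (coreBaseOf ends ζ₀ h u)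
  have hq : Core (((fun _ => true), true, true, true, fun _ => true) :
      Pt (uArms ends h u p ζ₀) (farArms ends h u p ζ₀)) := core_top
  rw [← htop]
  unfold mixedData
  rw [coreBaseOf_mixedReal_core hj hl hζ₀ hk₀ hd₀ hq, uArms_mixedReal_core hj hl hζ₀ hk₀ hd₀ hq,
    AhOf_mixedReal_core hj hl hζ₀ hk₀ hd₀ hq, farArms_mixedReal_core hj hl hζ₀ hk₀ hd₀ hq]

/-- **Every `Q`-point of the mixed block of a core-kind point with blue dead edges lies in the
class with the key of that point.** -/
theorem keyM_eq_of_mem_mixedBlock {ζ₀ : Config E} (hζ₀ : ζ₀ ∈ swOutSide ends l h o U ξ)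
    (hk₀ : CoreKind ends U h u ζ₀) (hd₀ : DeadBlue ends h u p ζ₀) {ζ' : Config E}
    (hζ' : ζ' ∈ mixedBlock ends u p (mixedData ends h u p ζ₀))
    (hQ : ζ' ∈ tgtU ends l h {T : Set V | o ∈ T}) :
    ζ' ∈ swOutSide ends l h o U ξ ∧
      keyM ends U ξ l h o u p ζ' = Sum.inr (Sum.inr (mixedData ends h u p ζ₀)) := by
  obtain ⟨q, hq, rfl⟩ := mem_mixedBlock.1 hζ'
  have hb := mixedBase_of_coreKind hj hl hζ₀ hk₀ hd₀
  haveI : Nonempty (uArms ends h u p ζ₀) := uArms_nonempty_of_coreKind hj hl hζ₀ hk₀ hd₀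
  have hup := hj.hup
  have hqRB := hq
  rw [leak'_iff, not_or] at hqRB
  rcases (not_leak'_iff q).1 hq with hC | hesc
  · -- a core point: the constancy of the key
    refine ⟨mem_swOutSide.2 ⟨hQ, mixedReal_core_mem_outClass hj hl hζ₀ hk₀ hd₀ hC⟩, ?_⟩
    have hk' := coreKind_mixedReal_core hj hl hζ₀ hk₀ hd₀ hC
    rw [keyM_of_coreMixed hk'.1 hk'.2 (dead_blue_mixedReal_core hj hl hζ₀ hk₀ hd₀ hC)]
    unfold mixedData
    rw [coreBaseOf_mixedReal_core hj hl hζ₀ hk₀ hd₀ hC, uArms_mixedReal_core hj hl hζ₀ hk₀ hd₀ hC,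
      AhOf_mixedReal_core hj hl hζ₀ hk₀ hd₀ hC, farArms_mixedReal_core hj hl hζ₀ hk₀ hd₀ hC]
  · -- an escaping point: the data read off the point is the data of the base
    have hcl := hb.mixedReal_mem_outClass hup (arms_subset_of_coreKind hj hζ₀ hk₀)
      (coreBaseOf_agree hζ₀ hk₀) hqRB.1 hqRB.2
    refine ⟨mem_swOutSide.2 ⟨hQ, hcl⟩, ?_⟩
    have hu' := hb.u_mem_hull hup hqRB.1 hqRB.2
    have hesc' := not_hull_u_subset_esc hj hl ho hζ₀ hk₀ hd₀ hesc
    have hbase := hb.baseE_esc hup (exists_dead_edge hj ζ₀) (uArms_conn ζ₀) (hAh ζ₀ hζ₀ hk₀)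
      (farArms_conn ζ₀) hqRB.1 hqRB.2 hesc
    have hdata : mixedData ends h u p ζ₀ = mixedData ends h u p (baseE ends h u p
        (mixedReal ends u p (fun P : uArms ends h u p ζ₀ => P.1) (AhOf ends h u p ζ₀)
          (fun P : farArms ends h u p ζ₀ => P.1) (coreBaseOf ends ζ₀ h u) q)) := by
      rw [hbase, mixedData_coreBaseOf hj hl hζ₀ hk₀ hd₀]
    have hm : MixedKindE ends U ξ l h o u p (mixedReal ends u p (fun P : uArms ends h u p ζ₀ => P.1)
        (AhOf ends h u p ζ₀) (fun P : farArms ends h u p ζ₀ => P.1) (coreBaseOf ends ζ₀ h u) q) :=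
      ⟨ζ₀, hζ₀, hk₀, hd₀, hdata, hζ'⟩
    rw [keyM_of_escMixed hu' hesc' hm, ← hdata]

omit ho hAh in
/-- **The mixed block of a core-kind point with blue dead edges satisfies the rigid
inequality.** -/
theorem card_mixedBlock_le {ζ₀ : Config E} (hζ₀ : ζ₀ ∈ swOutSide ends l h o U ξ)
    (hk₀ : CoreKind ends U h u ζ₀) (hd₀ : DeadBlue ends h u p ζ₀) {𝓔 : Set (Set E)}
    (h𝓔 : IsUpperSet 𝓔) :
    ((mixedBlock ends u p (mixedData ends h u p ζ₀)).filter fun ζ' =>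
        ζ' ∈ tgtU ends l h {T : Set V | o ∈ T} ∧ redEdges ends ζ' h ∈ 𝓔).card ≤
      ((mixedBlock ends u p (mixedData ends h u p ζ₀)).filter fun ζ' =>
        ζ' ∈ tgtU ends l h {T : Set V | o ∈ T} ∧ blueEdges ends ζ' h ∈ 𝓔).card := by
  have hb := mixedBase_of_coreKind hj hl hζ₀ hk₀ hd₀
  haveI : Nonempty (uArms ends h u p ζ₀) := uArms_nonempty_of_coreKind hj hl hζ₀ hk₀ hd₀
  obtain ⟨ed, y, hey, hyA⟩ := exists_dead_edge hj ζ₀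
  have key := hb.rigid_block hj.hup ⟨ed, y, hyA, p, ends_swap hey⟩ (exists_edge_F hj hζ₀ hk₀)
    (exists_ext_edge hj hζ₀ hk₀) (arms_subset_of_coreKind hj hζ₀ hk₀) hl hj.hou h𝓔
  exact key

end BigBlock

end Summit.Ventures.PercRepro2
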